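import Summits.BirchSwinnertonDyer.BirchSwinnertonDyer.Theses.EisensteinPrimes
import Summits.BirchSwinnertonDyer.Rank1Residual.X2.TamagawaSqueeze
import Summits.BirchSwinnertonDyer.Rank1Residual.X2.RankOneHeegnerExact
import Summits.BirchSwinnertonDyer.Rank1Residual.X2.IsogenyClassStability
import Summits.BirchSwinnertonDyer.BirchSwinnertonDyer.Theorems.EisensteinPrimesMazurMCOnCellBLocate
import Summits.BirchSwinnertonDyer.BirchSwinnertonDyer.Theorems.EisensteinPrimesAlgebraicLambdaGEBudget
import Literature.Barriers.BirchSwinnertonDyer.EisensteinMuConjecture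
import Literature.NumberTheory.EllipticCurves.TateCurve.NumberFieldUniformization
import Literature.NumberTheory.EllipticCurves.TateCurve.NumberFieldUniformizationTwisted
import HarnessLib

/-!
# Crux `MazurMCOnCellB` (stmt-BirchSwinnertonDyer-19033) — the line `mudescent` (Λ-adic isogeny
# μ-descent) AS A THEOREM OF THE TREE: the crux BY NAME from the route's published inputs and the two
# registered open stubs, stated verbatim as hypotheses (the "door" of the line), with its by-products

Cell `bsd-eis` (FULL-BSD rank-≤1 programme D-0033, HOME `run/shared/lean/pub/bsd-eis/`), seat
`bsd-eis-ky` gen 8 (prover; OWNER of the skeleton of record `mudescent` v2 on the item, sha16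
bcae135bb29b64aa, registered 2026-08-26 by gen 7 — `ledger crux write` is refused for this unit, so the
skeleton itself lives only as item evidence; THIS file puts its logical content into the tree by name).
Route `route-BirchSwinnertonDyer-EisensteinPrimes` (rung K5), crux 3 = row A10 of the ladder = corner
X2, sub-cell X2b (`r_an = 0`, odd MULTIPLICATIVE `p`, `E[p]` reducible, `¬ GVPar` = type A; 83 split +
44 non-split census cells at `p = 3`).

WHAT IS PROVED (theorems only; `--supports` the item, closes nothing):
* `mazurMCOnCellB_of_analyticMuZero_offLocus_of_lambdaCount_offLocus` — THE DOOR: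
  `Summit.…Theses.EisensteinPrimes.MazurMCOnCellB` (verbatim) from `EisensteinPrimes.PublishedInputs`
  (the route's support item -19037, fact-grade) + the two registered stubs of `mudescent` v2 AS
  HYPOTHESES, each stated byte-for-byte as registered (`stub_analyticMuZero_offLocus`: `μ_an(W₀) = 0`
  for every X2b pair OFF the `μ`-barrier locus `HasRamifiedOddLineAt`; `stub_lambdaCount_offLocus`:
  `λ_an(W₀) = n ≤ k (+1 at a split prime) ≤ λ(X(W₀/ℚ_∞))` there). Composition = the registered
  `MazurMCOnCellB_of`: DESCEND (`stub_locate`, LANDED p443911) → class transport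
  (`X2.cellB_iff_of_isIsogenous`, Tate uniformisation discharged) → route T at `p ‖ N`
  (`X2.mazurMainConjectureAt_of_algebraicLambdaGE`: Wuthrich Thm. 16 + squeeze) → ASCEND
  (`X2.mazurMainConjectureAt_of_isIsogenous`: rank 0, Cassels + `MC ⟺ BSDp`).
* `mazurMainConjectureAt_of_offLocus_member` — the PER-PAIR form of the same composition: at an X2b
  pair `(W, p)`, ANY isogenous member `W₀` with the two analytic/algebraic data AT `W₀`
  (`AnalyticMuLE W₀ p 0`, `AnalyticLambdaEq W₀ p n`, `AlgebraicLambdaGE W₀ p k`, `n ≤ k (+1)`) gives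
  Mazur's main conjecture at `(W, p)`; the published inputs enter as eleven named hypotheses (the
  conjuncts of `PublishedInputs` the line consumes). No `¬ HasRamifiedOddLineAt` hypothesis is needed
  for the implication — the locus only says WHERE `μ_an = 0` can hold (EisensteinMuBarrier).
* `mu_eq_zero_offLocus_of_analyticMuZero_offLocus` — BY-PRODUCT: granted Wuthrich 2014 Thm. 16 and
  modularity, stub 3 ALONE yields Greenberg's Conj. 1.11 on X2b in its located form: at every X2b pair
  off the locus, `X(W₀/ℚ_∞)` is `Λ`-torsion with `μ = 0` for every cyclotomic dual datum (Kato–Wuthrich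
  direction `μ_alg ≤ μ_an`, lam-b's `X2.isTorsion_and_mu_le_of_analyticMuLE`); and
  `exists_isIsogenous_mu_eq_zero_of_analyticMuZero_offLocus` — every X2b pair is `ℚ`-isogenous to a
  member with `μ = 0` (Greenberg's "∃ member with μ = 0" form), via `stub_locate`.

WHY A DOOR. The crux is open-problem grade class-wide (Greenberg–Vatsal treat type B; type A = GV p. 5
«we can prove very little»); the two stubs are its honest located residual in `(μ, λ)` currency at
the étale end, each crux-sized (five construction seats mu-a/b/c, lam-a/b, 2026-08-26/27: census and
per-pair certificates, no class-wide theorem; lam-a's (C-λ) `AnalyticCongruenceTransferTypeA` =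
aside -20112 is the typed research object behind stub 4's analytic half). Per pair both stubs ARE the
cell's certificates (two-engine `AnalyticMuLE`/`AnalyticLambdaEq` readings; `AlgebraicLambdaGE` from
Tamagawa / torsion / layer-rank witnesses, files `EisensteinPrimesAlgebraicLambdaGEBudget`,
`EisensteinPrimesX2LambdaCountAtPair`, …), so the per-pair theorem here is the common socket behind
every route-G / route-T display of row A10. Refuters may now attack the conjunction BY NAME.

HONEST FRAMING: nothing here proves a main conjecture or books a cell; BSD is proved for no curve; the
hypotheses `hμ`/`hlc` of the door are OPEN statements (not Literature facts, not `_OPEN` defs — plain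
hypotheses), and `PublishedInputs` is published mathematics taken by name exactly as the route's
`Assembly` takes it.

References: [GreenbergLNM1716] Conj. 1.11 (p. 58), Prop. 5.7 (p. 113), Cor. 5.6 (p. 136), §5 p. 131;
[GreenbergVatsal2000] (1)–(2), §3 Rem. after Cor. (3.8), p. 5; [Wuthrich2014] Thm. 16 (p. 397);
[SteinWuthrich2013] Thm. 6.1; [PerrinRiou1989Isogenie] Théorème (p. 349); [Stevens1989] Cor. 4.13 /
Rem. 4.14; HOME/ky-g7/Lines-mudescent.md (line card), HOME/ky-g8/ (this seat's mirror).
-/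

set_option linter.dupNamespace false
set_option autoImplicit false

namespace Summit.BirchSwinnertonDyer.BirchSwinnertonDyer.Theorems.EisensteinPrimesMazurMCOnCellBMudescent

open WeierstrassCurve
open Literature.NumberTheory.EllipticCurves Literature.NumberTheory.EllipticCurves.Rank1Residual
  Literature.NumberTheory.EllipticCurves.ModularForms
  Literature.NumberTheory.EllipticCurves.Wuthrich2014 Literature.NumberTheory.EllipticCurves.SteinWuthrich2013
open Literature.Barriers.BirchSwinnertonDyer (HasRamifiedOddLineAt)
open Summit.BirchSwinnertonDyer.Rank1Residual
open Summit.BirchSwinnertonDyer.BirchSwinnertonDyer.Theses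
open Summit.BirchSwinnertonDyer.BirchSwinnertonDyer.Theorems.EisensteinPrimesAlgebraicLambdaGEBudget

/-! ## §1. The per-pair composition: route T at an isogenous member, then ascent -/

/-- **Mazur's main conjecture at an X2b pair from the `(μ, λ)` data of ANY isogenous member** (the
per-pair form of the line `mudescent`; the member is typically the étale end `W₀` supplied by
`stub_locate`). Published inputs BY NAME (all conjuncts of the route's `PublishedInputs`): Wuthrich
2014 Thm. 16 at a reducible multiplicative prime (`hWu`), Stein–Wuthrich 2013 Thm. 6.1 split /
non-split (`hJs hJn`) with the canonical multiplicative heights (`hHs hHn`), Gross–Zagier–Kolyvagin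
(`hGZK`), modularity (`hnf hpar`), Cassels' isogeny invariance of the BSD quotient (`hCassels`),
Greenberg–Stevens (`hGS`). Data: `X2.CellB W p`, `IsIsogenous W W₀`, `X2.AnalyticMuLE W₀ p 0`
(`μ_an(W₀) = 0`), `X2.AnalyticLambdaEq W₀ p n` (`λ_an(W₀) = n`, trivial zero included),
`X1.TamagawaSqueeze.AlgebraicLambdaGE W₀ p k` (`λ(X(W₀/ℚ_∞)) ≥ k`), `n ≤ k` at a non-split and
`n ≤ k + 1` at a split prime. Proof: `X2.CellB` transports to `W₀` (`X2.cellB_iff_of_isIsogenous`,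
Tate uniformisation V.5.3/V.5.4 discharged), route T at `(W₀, p)`
(`X2.mazurMainConjectureAt_of_algebraicLambdaGE`), ascent along `W₀ ∼ W` at analytic rank `0`
(`X2.mazurMainConjectureAt_of_isIsogenous`). [cite: Wuthrich2014, Thm. 16 (p. 397)]
[cite: GreenbergLNM1716, Cor. 5.6 (proof, p. 136) and Conj. 1.11 (p. 58)]
[cite: PerrinRiou1989Isogenie, Théorème (p. 349)] -/
theorem mazurMainConjectureAt_of_offLocus_member
    (hWu : thm16_charIdeal_dvd_multiplicative_of_reducible)
    (hJs : thm61_splitMultiplicative) (hJn : thm61_nonsplitMultiplicative)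
    (hHs : exists_isSplitMultCanonical) (hHn : exists_isMultCanonical)
    (hGZK : rank_eq_analyticRank_of_analyticRank_le_one) (hnf : exists_isNewformOf)
    (hpar : nonempty_modularParametrizationData) (hCassels : bsdRHS_eq_of_isIsogenous)
    (hGS : ∀ (W : WeierstrassCurve ℚ) [W.IsElliptic] [W.IsGloballyMinimal] (p : ℕ) [Fact p.Prime],
      greenberg_stevens (W := W) (p := p))
    (W : WeierstrassCurve ℚ) [W.IsElliptic] [W.IsGloballyMinimal] (p : ℕ) [Fact p.Prime]
    (hc : X2.CellB W p) (W₀ : WeierstrassCurve ℚ) [W₀.IsElliptic] [W₀.IsGloballyMinimal]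
    (hiso : IsIsogenous W W₀) {n k : ℕ} (hμ₀ : X2.AnalyticMuLE W₀ p 0)
    (hlam : X2.AnalyticLambdaEq W₀ p n) (halg : X1.TamagawaSqueeze.AlgebraicLambdaGE W₀ p k)
    (hkN : ¬ W₀.HasSplitMultiplicativeReductionAtPrime p → n ≤ k)
    (hkS : W₀.HasSplitMultiplicativeReductionAtPrime p → n ≤ k + 1) :
    X2.MazurMainConjectureAt W p := by
  have hc₀ : X2.CellB W₀ p :=
    (X2.cellB_iff_of_isIsogenous (p := p) TateCurve.Silverman1994_thmV53_tateUniformisation_holds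
      TateCurve.Silverman1994_thmV53_corV54_tateUniformisation_holds hiso).mp hc
  have hp2 : p ≠ 2 := hc₀.2.1.1
  have hred₀ : ¬ W₀.HasIrreducibleModPGaloisRep p := hc₀.2.1.2.1
  have hmult₀ : W₀.HasMultiplicativeReductionAtPrime p := hc₀.2.1.2.2
  have hr₀ : W₀.analyticRank = 0 := hc₀.1
  have hMC₀ : X2.MazurMainConjectureAt W₀ p :=
    X2.mazurMainConjectureAt_of_algebraicLambdaGE hWu W₀ p hp2 hmult₀ hred₀ hμ₀ hlam halg hkN hkS
  exact X2.mazurMainConjectureAt_of_isIsogenous hWu hJs hJn hHs hHn hGZK hnf hpar hCassels hGS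
    hiso.symm_of_charZero p hp2 hmult₀ hred₀ hr₀ hMC₀

/-! ## §2. The door: the crux by name from `PublishedInputs` and the two registered stubs -/

/-- **THE DOOR of line `mudescent` on crux 3.** The crux
`Summit.BirchSwinnertonDyer.BirchSwinnertonDyer.Theses.EisensteinPrimes.MazurMCOnCellB` (Mazur's
cyclotomic main conjecture at EVERY X2b pair) follows from the route's published inputs
`EisensteinPrimes.PublishedInputs` (support item stmt-BirchSwinnertonDyer-19037, fact-grade) and the
two registered open stubs of the skeleton of record `mudescent` v2 (bcae135bb29b64aa), taken as
hypotheses VERBATIM: `hμ` = `stub_analyticMuZero_offLocus` (`μ_an = 0` at every X2b pair off the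
`μ`-barrier locus — Greenberg's μ-conjecture in the Eisenstein multiplicative case, analytic face;
OPEN) and `hlc` = `stub_lambdaCount_offLocus` (the Greenberg–Vatsal λ-count extended to type A; OPEN).
Proof = the registered composition `MazurMCOnCellB_of`: DESCEND by `stub_locate` (LANDED p443911)
to `W₀` off the locus, then `mazurMainConjectureAt_of_offLocus_member`.
[cite: GreenbergLNM1716, Conj. 1.11 (p. 58), Prop. 5.7 (p. 113), Cor. 5.6 (p. 136)]
[cite: GreenbergVatsal2000, §3 Rem. after Cor. (3.8) and p. 5] [cite: Wuthrich2014, Thm. 16 (p. 397)] -/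
theorem mazurMCOnCellB_of_analyticMuZero_offLocus_of_lambdaCount_offLocus
    (hP : EisensteinPrimes.PublishedInputs)
    (hμ : ∀ (W₀ : WeierstrassCurve ℚ) [W₀.IsElliptic] [W₀.IsGloballyMinimal] (p : ℕ) [Fact p.Prime],
      X2.CellB W₀ p → ¬ HasRamifiedOddLineAt W₀ p → X2.AnalyticMuLE W₀ p 0)
    (hlc : ∀ (W₀ : WeierstrassCurve ℚ) [W₀.IsElliptic] [W₀.IsGloballyMinimal] (p : ℕ) [Fact p.Prime],
      X2.CellB W₀ p → ¬ HasRamifiedOddLineAt W₀ p →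
        ∃ n k : ℕ, X2.AnalyticLambdaEq W₀ p n ∧ X1.TamagawaSqueeze.AlgebraicLambdaGE W₀ p k ∧
          (¬ W₀.HasSplitMultiplicativeReductionAtPrime p → n ≤ k) ∧
          (W₀.HasSplitMultiplicativeReductionAtPrime p → n ≤ k + 1)) :
    Summit.BirchSwinnertonDyer.BirchSwinnertonDyer.Theses.EisensteinPrimes.MazurMCOnCellB := by
  unfold Summit.BirchSwinnertonDyer.BirchSwinnertonDyer.Theses.EisensteinPrimes.MazurMCOnCellB
  intro W _ _ p _ hc
  have hCassels := hP.2.1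
  have hpar := hP.2.2.2.2.1
  have hnf := hP.2.2.2.2.2.1
  have hGZK := hP.2.2.2.2.2.2.2.2.2.2.1
  have hWu := hP.2.2.2.2.2.2.2.2.2.2.2.2.2.2.1
  have hJs := hP.2.2.2.2.2.2.2.2.2.2.2.2.2.2.2.1
  have hJn := hP.2.2.2.2.2.2.2.2.2.2.2.2.2.2.2.2.1
  have hHs := hP.2.2.2.2.2.2.2.2.2.2.2.2.2.2.2.2.2.1
  have hHn := hP.2.2.2.2.2.2.2.2.2.2.2.2.2.2.2.2.2.2.1
  have hGS := hP.2.2.2.2.2.2.2.2.2.2.2.2.2.2.2.2.2.2.2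
  -- DESCEND
  obtain ⟨W₀, _, _, hiso, hoff⟩ := EisensteinPrimesMazurMCOnCellBLocate.stub_locate W p hc
  have hc₀ : X2.CellB W₀ p :=
    (X2.cellB_iff_of_isIsogenous (p := p) TateCurve.Silverman1994_thmV53_tateUniformisation_holds
      TateCurve.Silverman1994_thmV53_corV54_tateUniformisation_holds hiso).mp hc
  -- μ and λ off the locus, route T at `W₀`, ASCEND
  obtain ⟨n, k, hlam, halg, hkN, hkS⟩ := hlc W₀ p hc₀ hoff
  exact mazurMainConjectureAt_of_offLocus_member hWu hJs hJn hHs hHn hGZK hnf hpar hCassels hGS W p hc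
    W₀ hiso (hμ W₀ p hc₀ hoff) hlam halg hkN hkS

/-! ## §3. By-product: Greenberg's Conj. 1.11 on X2b from stub 3 alone -/

/-- **Stub 3 forces `μ_alg = 0` off the locus (Greenberg's Conj. 1.11 on X2b, located form).**
Granted Wuthrich 2014 Thm. 16 (`hWu`) and a modular parametrisation (`hpar`), the registered stub
`stub_analyticMuZero_offLocus` (hypothesis `hμ`, OPEN) implies: at every X2b pair `(W₀, p)` with no
ramified-odd rational `p`-line, for every cyclotomic `κ`, topological generator `γ` (a cyclotomic
variable) and every Pontryagin-dual datum `D` of `Sel_{p^∞}(W₀/ℚ_∞)`, `D.X` is `Λ`-torsion and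
`μ(D.X) = 0` — the Kato–Wuthrich direction `μ_alg ≤ μ_an` (lam-b's
`X2.isTorsion_and_mu_le_of_analyticMuLE` at `m = 0`). So on this line Greenberg's conjecture is a
COROLLARY of the analytic stub, not an input. [cite: GreenbergLNM1716, Conj. 1.11 (p. 58)]
[cite: Wuthrich2014, Thm. 16 (p. 397)] [cite: GreenbergVatsal2000, p. 2, (2) and p. 4] -/
theorem mu_eq_zero_offLocus_of_analyticMuZero_offLocus
    (hWu : thm16_charIdeal_dvd_multiplicative_of_reducible)
    (hpar : nonempty_modularParametrizationData)
    (hμ : ∀ (W₀ : WeierstrassCurve ℚ) [W₀.IsElliptic] [W₀.IsGloballyMinimal] (p : ℕ) [Fact p.Prime],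
      X2.CellB W₀ p → ¬ HasRamifiedOddLineAt W₀ p → X2.AnalyticMuLE W₀ p 0)
    (W₀ : WeierstrassCurve ℚ) [W₀.IsElliptic] [W₀.IsGloballyMinimal] (p : ℕ) [Fact p.Prime]
    (hc₀ : X2.CellB W₀ p) (hoff : ¬ HasRamifiedOddLineAt W₀ p)
    {κ : ZpExtension ℚ p} {γ : Field.absoluteGaloisGroup ℚ}
    (hκ : κ.IsCyclotomic) (hγ : κ.IsTopGenerator γ) (hγ' : IsCyclotomicVariable p γ)
    (D : W₀.SelmerDualData κ γ) : D.IsTorsion ∧ D.mu = 0 := by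
  obtain ⟨hX, hμle⟩ := X2.isTorsion_and_mu_le_of_analyticMuLE (W := W₀) (p := p) hWu hpar hc₀.2.1.1
    hc₀.2.1.2.2 hc₀.2.1.2.1 (hμ W₀ p hc₀ hoff) hκ hγ hγ' D
  exact ⟨hX, Nat.le_zero.mp hμle⟩

/-- **Greenberg's "some isogenous curve has `μ = 0`" on X2b from stub 3** (LNM 1716 p. 58: «it seems
reasonable to expect that every isogeny class contains a curve with `μ_E = 0`»): granted Wuthrich Thm.
16 and modularity, `stub_analyticMuZero_offLocus` (hypothesis `hμ`, OPEN) implies that every X2b pair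
`(W, p)` is `ℚ`-isogenous to a globally minimal `W₀` — the étale end produced by `stub_locate` (LANDED,
p443911) — all of whose cyclotomic dual data are torsion with `μ = 0`.
[cite: GreenbergLNM1716, Conj. 1.11 and the paragraph after it (p. 58)] [cite: Wuthrich2014, Thm. 16 (p. 397)] -/
theorem exists_isIsogenous_mu_eq_zero_of_analyticMuZero_offLocus
    (hWu : thm16_charIdeal_dvd_multiplicative_of_reducible)
    (hpar : nonempty_modularParametrizationData)
    (hμ : ∀ (W₀ : WeierstrassCurve ℚ) [W₀.IsElliptic] [W₀.IsGloballyMinimal] (p : ℕ) [Fact p.Prime],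
      X2.CellB W₀ p → ¬ HasRamifiedOddLineAt W₀ p → X2.AnalyticMuLE W₀ p 0)
    (W : WeierstrassCurve ℚ) [W.IsElliptic] [W.IsGloballyMinimal] (p : ℕ) [Fact p.Prime]
    (hc : X2.CellB W p) :
    ∃ (W₀ : WeierstrassCurve ℚ) (_ : W₀.IsElliptic) (_ : W₀.IsGloballyMinimal),
      IsIsogenous W W₀ ∧ ∀ (κ : ZpExtension ℚ p) (γ : Field.absoluteGaloisGroup ℚ),
        κ.IsCyclotomic → κ.IsTopGenerator γ → IsCyclotomicVariable p γ →
        ∀ D : W₀.SelmerDualData κ γ, D.IsTorsion ∧ D.mu = 0 := by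
  obtain ⟨W₀, _, _, hiso, hoff⟩ := EisensteinPrimesMazurMCOnCellBLocate.stub_locate W p hc
  have hc₀ : X2.CellB W₀ p :=
    (X2.cellB_iff_of_isIsogenous (p := p) TateCurve.Silverman1994_thmV53_tateUniformisation_holds
      TateCurve.Silverman1994_thmV53_corV54_tateUniformisation_holds hiso).mp hc
  exact ⟨W₀, ‹_›, ‹_›, hiso, fun κ γ hκ hγ hγ' D ↦
    mu_eq_zero_offLocus_of_analyticMuZero_offLocus hWu hpar hμ W₀ p hc₀ hoff hκ hγ hγ' D⟩

end Summit.BirchSwinnertonDyer.BirchSwinnertonDyer.Theorems.EisensteinPrimesMazurMCOnCellBMudescent
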